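import Literature.NumberTheory.Sieve.MontgomeryVaughan1975Lemma43PrimeSums
import Literature.NumberTheory.Sieve.MontgomeryVaughan1975Lemma43Tools
import Literature.NumberTheory.LFunctions.ExplicitFormulaPsiChar
import Literature.NumberTheory.LFunctions.PerronFormulaPsi
import HarnessLib

/-!
# Montgomery–Vaughan (1975), Lemma 4.3: prime sums over an interval from the truncated explicit
formulae — the block estimates — PROVED (from the explicit formulae as hypotheses)

H. L. Montgomery, R. C. Vaughan, *The exceptional set in Goldbach's problem*, Acta Arith. 27
(1975) 353–370 [MontgomeryVaughanActa1975], §4 Lemma 4.3; P. X. Gallagher, Invent. Math. 11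
(1970), §5. For naturals `2 ≤ u ≤ v` and `T ≥ 2`, subtracting the truncated explicit formula at
`u` from the one at `v` expresses the prime sum over `(u, v]` through the zeros:

* `exists_block_bound_char` — from MV I Theorem 12.10 (the tree's named fact
  `Literature.NumberTheory.LFunctions.truncatedExplicitFormula_psiChar`, taken as a hypothesis):
  for `χ` primitive mod `q > 1`,
  `‖∑_{u<p≤v} χ(p) log p + (Z(v) − Z(u))‖ ≤ 2√v log v + 2 log(v+1) + K(log v + (v/T) log²(qvT))`,
  `Z(x) = ∑_{ρ, |γ|≤T} m(ρ) x^ρ/ρ` (`charZeroSumTrunc χ x T`);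
* `exists_block_bound_zeta` — from MV I Theorem 12.5 (`truncatedExplicitFormula_psi`): for the
  character mod `1`,
  `‖∑_{u<p≤v} log p − (v − u) + (Z_ζ(v) − Z_ζ(u))‖ ≤ 2√v log v + 2 log v + 1 + C(log v + (v/T) log²(vT))`;
* the zero side over an interval: `charZeroSumTrunc_sub`, `zetaZeroSumTrunc_sub` (the differences
  as sums of `m(ρ)(v^ρ − u^ρ)/ρ`) and `norm_sum_mul_cpow_sub_div_le` —
  `‖∑_ρ m(ρ)(v^ρ − u^ρ)/ρ‖ ≤ (v − u) ∑_ρ m(ρ) u^{β−1}` (`MontgomeryVaughan1975Lemma43Tools`),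
  `sum_mul_rpow_le_of_le` (`u^{β−1} ≤ x₀^{β−1}` for `u ≥ x₀`).

The jumps `ψ₀` versus `ψ` at integers, the prime powers and the logarithmic terms of (12.3),
(12.6) are absorbed into the displayed elementary terms. No named facts are introduced; the two
explicit formulae enter as hypotheses `(hEF : truncatedExplicitFormula_psiChar)`,
`(hEFζ : truncatedExplicitFormula_psi)`.
-/

noncomputable section

open Finset Real
open scoped ArithmeticFunction.vonMangoldt Chebyshev

namespace Literature.NumberTheory.Sieve.MontgomeryVaughan1975

open Literature.NumberTheory.LFunctions
open Literature.NumberTheory.Sieve (chebyshevPsiChar)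

/-! ### The zero side over an interval -/

/-- **`‖∑_ρ m(ρ)(v^ρ − u^ρ)/ρ‖ ≤ (v − u) ∑_ρ m(ρ) u^{Re ρ − 1}`** for `0 < u ≤ v`, nonnegative weights
and zeros `ρ ≠ 0` with `Re ρ ≤ 1` (termwise `norm_cpow_sub_cpow_div_le`). [cite: Gallagher1970, §5] -/
theorem norm_sum_mul_cpow_sub_div_le (S : Finset ℂ) (m : ℂ → ℝ) {u v : ℝ} (hu : 0 < u)
    (huv : u ≤ v) (hm : ∀ ρ ∈ S, 0 ≤ m ρ) (hS : ∀ ρ ∈ S, ρ ≠ 0 ∧ ρ.re ≤ 1) :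
    ‖∑ ρ ∈ S, ((m ρ : ℝ) : ℂ) * ((((v : ℝ) : ℂ) ^ ρ - ((u : ℝ) : ℂ) ^ ρ) / ρ)‖ ≤
      (v - u) * ∑ ρ ∈ S, m ρ * u ^ (ρ.re - 1) := by
  refine (norm_sum_le _ _).trans ?_
  rw [Finset.mul_sum]
  refine Finset.sum_le_sum fun ρ hρ => ?_
  rw [norm_mul, Complex.norm_real, Real.norm_of_nonneg (hm ρ hρ)]
  have h := norm_cpow_sub_cpow_div_le hu huv (hS ρ hρ).1 (hS ρ hρ).2
  calc m ρ * ‖((((v : ℝ) : ℂ) ^ ρ - ((u : ℝ) : ℂ) ^ ρ) / ρ)‖ ≤ m ρ * ((v - u) * u ^ (ρ.re - 1)) :=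
        mul_le_mul_of_nonneg_left h (hm ρ hρ)
    _ = (v - u) * (m ρ * u ^ (ρ.re - 1)) := by ring

/-- `∑_ρ m(ρ) u^{Re ρ − 1} ≤ ∑_ρ m(ρ) x₀^{Re ρ − 1}` for `0 < x₀ ≤ u` (`Re ρ ≤ 1`, `m ≥ 0`). [folklore] -/
theorem sum_mul_rpow_le_of_le (S : Finset ℂ) (m : ℂ → ℝ) {x₀ u : ℝ} (hx₀ : 0 < x₀) (hu : x₀ ≤ u)
    (hm : ∀ ρ ∈ S, 0 ≤ m ρ) (hS : ∀ ρ ∈ S, ρ.re ≤ 1) :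
    ∑ ρ ∈ S, m ρ * u ^ (ρ.re - 1) ≤ ∑ ρ ∈ S, m ρ * x₀ ^ (ρ.re - 1) :=
  Finset.sum_le_sum fun ρ hρ => mul_le_mul_of_nonneg_left
    (Real.rpow_le_rpow_of_nonpos hx₀ hu (by linarith [hS ρ hρ])) (hm ρ hρ)

/-- The difference of the truncated zero sums of `L(s, χ)` (`χ ≠ χ₀`) at `v` and `u`:
`Z(v) − Z(u) = ∑_{ρ} m(ρ)(v^ρ − u^ρ)/ρ` over the box `lfunctionZeroBox χ T`. [folklore] -/
theorem charZeroSumTrunc_sub {q : ℕ} [NeZero q] {χ : DirichletCharacter ℂ q} (hχ : χ ≠ 1)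
    (v u T : ℝ) :
    charZeroSumTrunc χ v T - charZeroSumTrunc χ u T =
      ∑ ρ ∈ (lfunctionZeroBox_finite hχ T).toFinset,
        ((DirichletDisc.zeroOrder χ ρ : ℝ) : ℂ) * ((((v : ℝ) : ℂ) ^ ρ - ((u : ℝ) : ℂ) ^ ρ) / ρ) := by
  rw [charZeroSumTrunc_eq hχ, charZeroSumTrunc_eq hχ, ← Finset.sum_sub_distrib]
  refine Finset.sum_congr rfl fun ρ _ => ?_
  push_cast
  ring

/-- Members of the box: `L(ρ, χ) = 0`, `0 < Re ρ < 1`, `|Im ρ| ≤ T`; in particular `ρ ≠ 0`,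
`Re ρ ≤ 1`. [folklore] -/
theorem mem_toFinset_lfunctionZeroBox {q : ℕ} [NeZero q] {χ : DirichletCharacter ℂ q} (hχ : χ ≠ 1)
    {T : ℝ} {ρ : ℂ} (h : ρ ∈ (lfunctionZeroBox_finite hχ T).toFinset) :
    χ.LFunction ρ = 0 ∧ 0 < ρ.re ∧ ρ.re < 1 ∧ |ρ.im| ≤ T := by
  rwa [Set.Finite.mem_toFinset, mem_lfunctionZeroBox] at h

/-- Members of the box are `≠ 0` and have `Re ρ ≤ 1`. [folklore] -/
theorem ne_zero_and_re_le_of_mem {q : ℕ} [NeZero q] {χ : DirichletCharacter ℂ q} (hχ : χ ≠ 1)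
    {T : ℝ} {ρ : ℂ} (h : ρ ∈ (lfunctionZeroBox_finite hχ T).toFinset) : ρ ≠ 0 ∧ ρ.re ≤ 1 := by
  obtain ⟨-, h0, h1, -⟩ := mem_toFinset_lfunctionZeroBox hχ h
  refine ⟨fun h' => ?_, h1.le⟩
  rw [h', Complex.zero_re] at h0
  exact lt_irrefl _ h0

/-- The difference of the truncated zero sums of `ζ` at `v` and `u`:
`Z_ζ(v) − Z_ζ(u) = ∑_ρ m(ρ)(v^ρ − u^ρ)/ρ` over `weilZeroIndex T`. [folklore] -/
theorem zetaZeroSumTrunc_sub (v u T : ℝ) :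
    zetaZeroSumTrunc v T - zetaZeroSumTrunc u T =
      ∑ ρ ∈ (weilZeroIndex_finite T).toFinset,
        (((riemannZetaZeroOrder ρ : ℤ) : ℝ) : ℂ) * ((((v : ℝ) : ℂ) ^ ρ - ((u : ℝ) : ℂ) ^ ρ) / ρ) := by
  rw [zetaZeroSumTrunc, zetaZeroSumTrunc, ← Finset.sum_sub_distrib]
  refine Finset.sum_congr rfl fun ρ _ => ?_
  push_cast
  ring

/-- Members of `weilZeroIndex T`: `ζ(ρ) = 0`, `0 ≤ Re ρ ≤ 1`, `Im ρ ≠ 0`, `|Im ρ| ≤ T`; the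
multiplicity is nonnegative. [folklore] -/
theorem mem_toFinset_weilZeroIndex {T : ℝ} {ρ : ℂ} (h : ρ ∈ (weilZeroIndex_finite T).toFinset) :
    riemannZeta ρ = 0 ∧ 0 ≤ ρ.re ∧ ρ.re ≤ 1 ∧ ρ.im ≠ 0 ∧ |ρ.im| ≤ T ∧ ρ ≠ 0 ∧ ρ ≠ 1 ∧
      0 ≤ ((riemannZetaZeroOrder ρ : ℤ) : ℝ) := by
  rw [Set.Finite.mem_toFinset] at h
  obtain ⟨h0, h1, h2, h3, h4⟩ := h
  have hmem : ρ ∈ weilZeroIndex T := ⟨h0, h1, h2, h3, h4⟩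
  refine ⟨h0, h1, h2, h3, h4, ne_zero_of_mem_weilZeroIndex hmem, ne_one_of_mem_weilZeroIndex hmem,
    ?_⟩
  exact_mod_cast riemannZetaZeroOrder_nonneg (ne_one_of_mem_weilZeroIndex hmem)

/-! ### `ψ₀` at integers -/

/-- `ψ(n) = ψ(n − 1) + Λ(n)` for `n ≥ 1`. [folklore] -/
theorem chebyshevPsi_natCast_eq (n : ℕ) (hn : 1 ≤ n) :
    ψ (n : ℝ) = ψ ((n - 1 : ℕ) : ℝ) + Λ n := by
  rw [Chebyshev.psi, Chebyshev.psi, Nat.floor_natCast, Nat.floor_natCast]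
  conv_lhs => rw [show n = (n - 1) + 1 by omega]
  rw [Finset.sum_Ioc_succ_top (Nat.zero_le _), Nat.sub_add_cancel hn]

/-- `ψ₀(n) = ψ(n) − Λ(n)/2` at a natural number `n ≥ 1`. [folklore] -/
theorem chebyshevPsi₀_natCast {n : ℕ} (hn : 1 ≤ n) :
    chebyshevPsi₀ n = ψ (n : ℝ) - Λ n / 2 := by
  rw [PerronPsi.chebyshevPsi₀_eq, Nat.ceil_natCast, chebyshevPsi_natCast_eq n hn]
  ring

/-! ### Elementary bounds for the logarithmic terms -/

/-- Monotone bookkeeping of the remainder of (12.8)/(12.4): for `2 ≤ u ≤ v`, `T ≥ 2`, `q ≥ 1`,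
`log u · min(1, ·) + (u/T) log²(quT) ≤ log v + (v/T) log²(qvT)`. [folklore] -/
theorem remainder_mono {u v T q : ℝ} (hu : 2 ≤ u) (huv : u ≤ v) (hT : 2 ≤ T) (hq : 1 ≤ q)
    (m : ℝ) (hm1 : m ≤ 1) :
    Real.log u * m + u / T * Real.log (q * u * T) ^ 2 ≤
      Real.log v + v / T * Real.log (q * v * T) ^ 2 := by
  have hu0 : 0 < u := by linarith
  have hv0 : 0 < v := by linarith
  have hT0 : 0 < T := by linarith
  have hlogu : 0 ≤ Real.log u := Real.log_nonneg (by linarith)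
  have hloguv : Real.log u ≤ Real.log v := Real.log_le_log hu0 huv
  have h1 : Real.log u * m ≤ Real.log v := by
    calc Real.log u * m ≤ Real.log u * 1 := mul_le_mul_of_nonneg_left hm1 hlogu
      _ ≤ Real.log v := by rw [mul_one]; exact hloguv
  have hquT : 1 ≤ q * u * T :=
    one_le_mul_of_one_le_of_one_le (one_le_mul_of_one_le_of_one_le hq (by linarith)) (by linarith)
  have hlog0 : 0 ≤ Real.log (q * u * T) := Real.log_nonneg hquT
  have hlogle : Real.log (q * u * T) ≤ Real.log (q * v * T) :=
    Real.log_le_log (by positivity)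
      (mul_le_mul_of_nonneg_right (mul_le_mul_of_nonneg_left huv (by linarith)) hT0.le)
  have h2 : Real.log (q * u * T) ^ 2 ≤ Real.log (q * v * T) ^ 2 := pow_le_pow_left₀ hlog0 hlogle 2
  have h3 : u / T ≤ v / T := div_le_div_of_nonneg_right huv hT0.le
  have h4 : u / T * Real.log (q * u * T) ^ 2 ≤ v / T * Real.log (q * v * T) ^ 2 :=
    mul_le_mul h3 h2 (sq_nonneg _) (by positivity)
  linarith

/-- `|log(1 − 1/x²)| ≤ 1` for `x ≥ 2`. [folklore] -/
theorem abs_log_one_sub_inv_sq_le {x : ℝ} (hx : 2 ≤ x) : |Real.log (1 - 1 / x ^ 2)| ≤ 1 := by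
  have hx2 : 4 ≤ x ^ 2 := by nlinarith
  have ht : 0 < 1 - 1 / x ^ 2 := by
    have : 1 / x ^ 2 ≤ 1 / 4 := by
      rw [div_le_div_iff₀ (by positivity) (by norm_num)]; linarith
    linarith
  have hle : Real.log (1 - 1 / x ^ 2) ≤ 0 := Real.log_nonpos ht.le (by
    have : 0 ≤ 1 / x ^ 2 := by positivity
    linarith)
  have hge : -1 ≤ Real.log (1 - 1 / x ^ 2) := by
    -- `log t ≥ 1 − 1/t` and `1/t ≤ 4/3`
    have h1 := Real.one_sub_inv_le_log_of_pos ht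
    have h2 : (1 - 1 / x ^ 2)⁻¹ ≤ 2 := by
      rw [inv_le_comm₀ ht (by norm_num)]
      have : 1 / x ^ 2 ≤ 1 / 4 := by
        rw [div_le_div_iff₀ (by positivity) (by norm_num)]; linarith
      linarith
    linarith
  rw [abs_le]
  exact ⟨hge, by linarith⟩

/-! ### The block estimate for `χ ≠ χ₀` primitive (MV I Theorem 12.10 at `u` and `v`) -/

/-- **The prime sum over `(u, v]` against the zeros, `χ` primitive mod `q > 1`** (Gallagher 1970
§5; M–V 1975 Lemma 4.3): assuming MV I Theorem 12.10 (`truncatedExplicitFormula_psiChar`), there is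
`K ≥ 0` such that for all primitive `χ` mod `q > 1`, naturals `2 ≤ u ≤ v` and `T ≥ 2`,
`‖∑_{u<p≤v} χ(p) log p + (Z(v) − Z(u))‖ ≤ 2√v log v + 2 log(v + 1) + K (log v + (v/T) log²(qvT))`,
where `Z(x) = charZeroSumTrunc χ x T = ∑_{|γ|≤T} m(ρ)x^ρ/ρ`. (Subtract (12.6) at `u` from (12.6)
at `v`: the logarithmic terms differ by at most `log(v+1)`, the jumps `ψ − ψ₀` at the integers
`u, v` are `≤ ½ log`, the prime powers contribute `≤ ψ(v) − ϑ(v) ≤ 2√v log v`, and the two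
remainders (12.8) are each `≤ K₀(log v + (v/T) log²(qvT))`.)
[cite: MontgomeryVaughan2007, Theorem 12.10] [cite: MontgomeryVaughanActa1975, §4 Lemma 4.3] -/
theorem exists_block_bound_char (hEF : truncatedExplicitFormula_psiChar) :
    ∃ K : ℝ, 0 ≤ K ∧ ∀ (q : ℕ) [NeZero q], 1 < q → ∀ χ : DirichletCharacter ℂ q, χ.IsPrimitive →
      ∀ u v : ℕ, 2 ≤ u → u ≤ v → ∀ T : ℝ, 2 ≤ T →
        ‖charPrimeSum χ v (v - u) + (charZeroSumTrunc χ v T - charZeroSumTrunc χ u T)‖ ≤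
          2 * Real.sqrt v * Real.log v + 2 * Real.log (v + 1) +
            K * (Real.log v + v / T * Real.log (q * v * T) ^ 2) := by
  obtain ⟨K₀, hK₀⟩ := hEF 2 one_lt_two
  set K : ℝ := 2 * max K₀ 0 with hKdef
  have hK0 : 0 ≤ max K₀ 0 := le_max_right _ _
  refine ⟨K, by positivity, fun q _ hq χ hprim u v hu huv T hT => ?_⟩
  have hu2 : (2 : ℝ) ≤ u := by exact_mod_cast hu
  have hv2 : (2 : ℝ) ≤ v := le_trans hu2 (by exact_mod_cast huv)
  have huv' : (u : ℝ) ≤ v := by exact_mod_cast huv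
  have hq1 : (1 : ℝ) ≤ q := by exact_mod_cast hq.le
  have hT0 : 0 < T := by linarith
  -- the explicit formula at `v` and at `u`
  set A : ℝ → ℂ := fun x => -charZeroSumTrunc χ x T - 1 / 2 * Real.log (x - 1) -
    χ (-1) / 2 * Real.log (x + 1) + explicitFormulaConst χ with hA
  set Rem : ℝ → ℝ := fun x => Real.log x * min 1 (x / (T * primePowDist x)) +
    x / T * Real.log (q * x * T) ^ 2 with hRem
  have hv := hK₀ q hq χ hprim v hv2 T hT
  have hu' := hK₀ q hq χ hprim u hu2 T hT
  change ‖chebyshevPsiChar₀ χ v - A v‖ ≤ K₀ * Rem v at hv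
  change ‖chebyshevPsiChar₀ χ u - A u‖ ≤ K₀ * Rem u at hu'
  -- the remainders are `≤ max K₀ 0 · (log v + (v/T) log²(qvT))`
  set E : ℝ := Real.log v + v / T * Real.log (q * v * T) ^ 2 with hE
  have hRem_le : ∀ x : ℝ, 2 ≤ x → x ≤ v → Rem x ≤ E := fun x hx hxv =>
    remainder_mono hx hxv hT hq1 _ (min_le_left _ _)
  have hRem0 : ∀ x : ℝ, 2 ≤ x → 0 ≤ Rem x := by
    intro x hx
    have hm0 : 0 ≤ min 1 (x / (T * primePowDist x)) :=
      le_min zero_le_one (div_nonneg (by linarith) (mul_nonneg hT0.le (primePowDist_nonneg x)))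
    have : 0 ≤ Real.log x := Real.log_nonneg (by linarith)
    positivity
  have hRv : ‖chebyshevPsiChar₀ χ v - A v‖ ≤ max K₀ 0 * E :=
    hv.trans ((mul_le_mul_of_nonneg_right (le_max_left _ _) (hRem0 v hv2)).trans
      (mul_le_mul_of_nonneg_left (hRem_le v hv2 le_rfl) hK0))
  have hRu : ‖chebyshevPsiChar₀ χ u - A u‖ ≤ max K₀ 0 * E :=
    hu'.trans ((mul_le_mul_of_nonneg_right (le_max_left _ _) (hRem0 u hu2)).trans
      (mul_le_mul_of_nonneg_left (hRem_le u hu2 huv') hK0))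
  -- the logarithmic terms
  have hlog1 : ‖(1 / 2 * Real.log ((v : ℝ) - 1) - 1 / 2 * Real.log ((u : ℝ) - 1) : ℂ)‖ ≤
      1 / 2 * Real.log (v + 1) := by
    have h0 : 0 ≤ Real.log ((u : ℝ) - 1) := Real.log_nonneg (by linarith)
    have h1 : Real.log ((u : ℝ) - 1) ≤ Real.log ((v : ℝ) - 1) :=
      Real.log_le_log (by linarith) (by linarith)
    have h2 : Real.log ((v : ℝ) - 1) ≤ Real.log (v + 1) :=
      Real.log_le_log (by linarith) (by linarith)
    have : (1 / 2 * Real.log ((v : ℝ) - 1) - 1 / 2 * Real.log ((u : ℝ) - 1) : ℂ) =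
        ((1 / 2 * (Real.log ((v : ℝ) - 1) - Real.log ((u : ℝ) - 1)) : ℝ) : ℂ) := by
      push_cast; ring
    rw [this, Complex.norm_real, Real.norm_of_nonneg (by linarith)]
    linarith
  have hlog2 : ‖(χ (-1) / 2 * Real.log ((v : ℝ) + 1) - χ (-1) / 2 * Real.log ((u : ℝ) + 1) : ℂ)‖ ≤
      1 / 2 * Real.log (v + 1) := by
    have h0 : 0 ≤ Real.log ((u : ℝ) + 1) := Real.log_nonneg (by linarith)
    have h1 : Real.log ((u : ℝ) + 1) ≤ Real.log ((v : ℝ) + 1) :=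
      Real.log_le_log (by linarith) (by linarith)
    have : (χ (-1) / 2 * Real.log ((v : ℝ) + 1) - χ (-1) / 2 * Real.log ((u : ℝ) + 1) : ℂ) =
        χ (-1) / 2 * (((Real.log ((v : ℝ) + 1) - Real.log ((u : ℝ) + 1) : ℝ)) : ℂ) := by
      push_cast; ring
    rw [this, norm_mul, norm_div, Complex.norm_two, Complex.norm_real,
      Real.norm_of_nonneg (by linarith)]
    have hχ1 : ‖χ (-1)‖ ≤ 1 := χ.norm_le_one _
    calc ‖χ (-1)‖ / 2 * (Real.log ((v : ℝ) + 1) - Real.log ((u : ℝ) + 1))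
        ≤ 1 / 2 * (Real.log ((v : ℝ) + 1) - Real.log ((u : ℝ) + 1)) := by
          apply mul_le_mul_of_nonneg_right _ (by linarith)
          linarith
      _ ≤ 1 / 2 * Real.log (v + 1) := by linarith
  -- `A v − A u = −(Z v − Z u) − (log terms)`
  have hAA : A v - A u = -(charZeroSumTrunc χ v T - charZeroSumTrunc χ u T) -
      ((1 / 2 * Real.log ((v : ℝ) - 1) - 1 / 2 * Real.log ((u : ℝ) - 1) : ℂ)) -
      ((χ (-1) / 2 * Real.log ((v : ℝ) + 1) - χ (-1) / 2 * Real.log ((u : ℝ) + 1) : ℂ)) := by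
    simp only [hA]; ring
  -- the jumps at the integers `u`, `v`
  have hJv : ‖chebyshevPsiChar₀ χ v - chebyshevPsiChar χ v‖ ≤ Real.log v / 2 :=
    norm_chebyshevPsiChar₀_sub_le χ (by linarith)
  have hJu : ‖chebyshevPsiChar₀ χ u - chebyshevPsiChar χ u‖ ≤ Real.log u / 2 :=
    norm_chebyshevPsiChar₀_sub_le χ (by linarith)
  have hloguv : Real.log u ≤ Real.log v := Real.log_le_log (by linarith) huv'
  have hlogv1 : Real.log v ≤ Real.log (v + 1) := Real.log_le_log (by linarith) (by linarith)
  have hlogv0 : 0 ≤ Real.log v := Real.log_nonneg (by linarith)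
  -- `ψ(v, χ) − ψ(u, χ) = charPrimeSum + prime powers`
  have hψ : chebyshevPsiChar χ v - chebyshevPsiChar χ u =
      charPrimeSum χ v (v - u) +
        ∑ n ∈ (Ioc (v - (v - u)) v).filter (fun n => ¬ n.Prime), χ n * Λ n := by
    rw [chebyshevPsiChar_natCast_sub χ huv, ← sum_Ioc_mul_vonMangoldt_eq χ v (v - u),
      Nat.sub_sub_self huv]
  have hPP := norm_sum_nonprime_le χ v (v - u)
  -- assemble: `cps + (Zv − Zu) = (ψv − ψu − PP) + (Zv − Zu)` and
  -- `ψv − ψu = (ψ₀v − Av) − (ψ₀u − Au) + (Av − Au) + jumps`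
  have hid : charPrimeSum χ v (v - u) + (charZeroSumTrunc χ v T - charZeroSumTrunc χ u T) =
      (chebyshevPsiChar₀ χ v - A v) - (chebyshevPsiChar₀ χ u - A u)
      - ((1 / 2 * Real.log ((v : ℝ) - 1) - 1 / 2 * Real.log ((u : ℝ) - 1) : ℂ))
      - ((χ (-1) / 2 * Real.log ((v : ℝ) + 1) - χ (-1) / 2 * Real.log ((u : ℝ) + 1) : ℂ))
      - (chebyshevPsiChar₀ χ v - chebyshevPsiChar χ v)
      + (chebyshevPsiChar₀ χ u - chebyshevPsiChar χ u)
      - ∑ n ∈ (Ioc (v - (v - u)) v).filter (fun n => ¬ n.Prime), χ n * Λ n := by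
    have h1 : charPrimeSum χ v (v - u) = (chebyshevPsiChar χ v - chebyshevPsiChar χ u) -
        ∑ n ∈ (Ioc (v - (v - u)) v).filter (fun n => ¬ n.Prime), χ n * Λ n := by
      rw [hψ]; ring
    rw [h1]
    have h2 := hAA
    linear_combination h2
  rw [hid]
  have hn := norm_sub_le
    ((chebyshevPsiChar₀ χ v - A v) - (chebyshevPsiChar₀ χ u - A u)
      - ((1 / 2 * Real.log ((v : ℝ) - 1) - 1 / 2 * Real.log ((u : ℝ) - 1) : ℂ))
      - ((χ (-1) / 2 * Real.log ((v : ℝ) + 1) - χ (-1) / 2 * Real.log ((u : ℝ) + 1) : ℂ))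
      - (chebyshevPsiChar₀ χ v - chebyshevPsiChar χ v)
      + (chebyshevPsiChar₀ χ u - chebyshevPsiChar χ u))
    (∑ n ∈ (Ioc (v - (v - u)) v).filter (fun n => ¬ n.Prime), χ n * Λ n)
  have hn2 := norm_add_le
    ((chebyshevPsiChar₀ χ v - A v) - (chebyshevPsiChar₀ χ u - A u)
      - ((1 / 2 * Real.log ((v : ℝ) - 1) - 1 / 2 * Real.log ((u : ℝ) - 1) : ℂ))
      - ((χ (-1) / 2 * Real.log ((v : ℝ) + 1) - χ (-1) / 2 * Real.log ((u : ℝ) + 1) : ℂ))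
      - (chebyshevPsiChar₀ χ v - chebyshevPsiChar χ v))
    (chebyshevPsiChar₀ χ u - chebyshevPsiChar χ u)
  have hn3 := norm_sub_le
    ((chebyshevPsiChar₀ χ v - A v) - (chebyshevPsiChar₀ χ u - A u)
      - ((1 / 2 * Real.log ((v : ℝ) - 1) - 1 / 2 * Real.log ((u : ℝ) - 1) : ℂ))
      - ((χ (-1) / 2 * Real.log ((v : ℝ) + 1) - χ (-1) / 2 * Real.log ((u : ℝ) + 1) : ℂ)))
    (chebyshevPsiChar₀ χ v - chebyshevPsiChar χ v)
  have hn4 := norm_sub_le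
    ((chebyshevPsiChar₀ χ v - A v) - (chebyshevPsiChar₀ χ u - A u)
      - ((1 / 2 * Real.log ((v : ℝ) - 1) - 1 / 2 * Real.log ((u : ℝ) - 1) : ℂ)))
    ((χ (-1) / 2 * Real.log ((v : ℝ) + 1) - χ (-1) / 2 * Real.log ((u : ℝ) + 1) : ℂ))
  have hn5 := norm_sub_le
    ((chebyshevPsiChar₀ χ v - A v) - (chebyshevPsiChar₀ χ u - A u))
    ((1 / 2 * Real.log ((v : ℝ) - 1) - 1 / 2 * Real.log ((u : ℝ) - 1) : ℂ))
  have hn6 := norm_sub_le (chebyshevPsiChar₀ χ v - A v) (chebyshevPsiChar₀ χ u - A u)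
  have hE0 : 0 ≤ E := by
    have := hRem0 v hv2
    have hRemv : Rem v ≤ E := hRem_le v hv2 le_rfl
    linarith
  have hsqrt : 0 ≤ 2 * Real.sqrt v * Real.log v := by positivity
  rw [hKdef]
  nlinarith [hRv, hRu, hlog1, hlog2, hJv, hJu, hPP, hn, hn2, hn3, hn4, hn5, hn6, hloguv, hlogv1,
    hlogv0, hE0, hK0]

/-! ### The block estimate for the character modulo `1` (MV I Theorem 12.5 at `u` and `v`) -/

/-- **The prime sum over `(u, v]` against the zeros of `ζ`** (the term `q = 1` of (4.2)):
assuming MV I Theorem 12.5 (`truncatedExplicitFormula_psi`), there is `C ≥ 0` such that for every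
character `χ` modulo `1`, naturals `2 ≤ u ≤ v` and `T ≥ 2`,
`‖(∑_{u<p≤v} log p − #(u, v]) + (Z_ζ(v) − Z_ζ(u))‖ ≤ 2√v log v + 2 log v + 1 + C (log v + (v/T) log²(vT))`,
`Z_ζ(x) = zetaZeroSumTrunc x T`; here `∑_{u<p≤v} log p − #(u, v] = gallagherTerm χ v (v − u)`.
(Subtract (12.3) at `u` from (12.3) at `v`: the main terms give `v − u = #(u, v]`, the terms
`½ log(1 − x⁻²)` are each `≤ ½` in size, the jumps `ψ − ψ₀ = Λ/2` at `u, v` are `≤ ½ log v`,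
the prime powers `≤ 2√v log v`, the remainders (12.4) `≤ C₀(log v + (v/T) log²(vT))` each.)
[cite: MontgomeryVaughan2007, Thm. 12.5 (12.3)–(12.4)] [cite: MontgomeryVaughanActa1975, §4 Lemma 4.3] -/
theorem exists_block_bound_zeta (hEFζ : truncatedExplicitFormula_psi) :
    ∃ C : ℝ, 0 ≤ C ∧ ∀ (χ : DirichletCharacter ℂ 1) (u v : ℕ), 2 ≤ u → u ≤ v → ∀ T : ℝ, 2 ≤ T →
      ‖gallagherTerm χ v (v - u) + (zetaZeroSumTrunc v T - zetaZeroSumTrunc u T)‖ ≤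
        2 * Real.sqrt v * Real.log v + 2 * Real.log v + 1 +
          C * (Real.log v + v / T * Real.log (v * T) ^ 2) := by
  obtain ⟨C₀, hC₀⟩ := hEFζ 2 one_lt_two
  set C : ℝ := 2 * max C₀ 0 with hCdef
  have hC0 : 0 ≤ max C₀ 0 := le_max_right _ _
  refine ⟨C, by positivity, fun χ u v hu huv T hT => ?_⟩
  have hu2 : (2 : ℝ) ≤ u := by exact_mod_cast hu
  have hv2 : (2 : ℝ) ≤ v := le_trans hu2 (by exact_mod_cast huv)
  have huv' : (u : ℝ) ≤ v := by exact_mod_cast huv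
  have hT0 : 0 < T := by linarith
  have hu1 : 1 ≤ u := by omega
  have hv1 : 1 ≤ v := by omega
  -- the explicit formula at `v` and at `u`
  set A : ℝ → ℂ := fun x => (x : ℂ) - zetaZeroSumTrunc x T - Real.log (2 * π) -
    1 / 2 * Real.log (1 - 1 / x ^ 2) with hA
  set Rem : ℝ → ℝ := fun x => Real.log x * min 1 (x / (T * primePowDist x)) +
    x / T * Real.log (x * T) ^ 2 with hRem
  have hv := hC₀ v hv2 T hT
  have hu' := hC₀ u hu2 T hT
  change ‖(chebyshevPsi₀ v : ℂ) - A v‖ ≤ C₀ * Rem v at hv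
  change ‖(chebyshevPsi₀ u : ℂ) - A u‖ ≤ C₀ * Rem u at hu'
  set E : ℝ := Real.log v + v / T * Real.log (v * T) ^ 2 with hE
  have hRem_le : ∀ x : ℝ, 2 ≤ x → x ≤ v → Rem x ≤ E := by
    intro x hx hxv
    have h := remainder_mono hx hxv hT le_rfl (min 1 (x / (T * primePowDist x))) (min_le_left _ _)
    simp only [one_mul] at h
    exact h
  have hRem0 : ∀ x : ℝ, 2 ≤ x → 0 ≤ Rem x := by
    intro x hx
    have hm0 : 0 ≤ min 1 (x / (T * primePowDist x)) :=
      le_min zero_le_one (div_nonneg (by linarith) (mul_nonneg hT0.le (primePowDist_nonneg x)))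
    have : 0 ≤ Real.log x := Real.log_nonneg (by linarith)
    positivity
  have hRv : ‖(chebyshevPsi₀ v : ℂ) - A v‖ ≤ max C₀ 0 * E :=
    hv.trans ((mul_le_mul_of_nonneg_right (le_max_left _ _) (hRem0 v hv2)).trans
      (mul_le_mul_of_nonneg_left (hRem_le v hv2 le_rfl) hC0))
  have hRu : ‖(chebyshevPsi₀ u : ℂ) - A u‖ ≤ max C₀ 0 * E :=
    hu'.trans ((mul_le_mul_of_nonneg_right (le_max_left _ _) (hRem0 u hu2)).trans
      (mul_le_mul_of_nonneg_left (hRem_le u hu2 huv') hC0))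
  -- the terms `½ log(1 − x⁻²)`
  have hL : ‖(1 / 2 * Real.log (1 - 1 / (v : ℝ) ^ 2) - 1 / 2 * Real.log (1 - 1 / (u : ℝ) ^ 2) : ℂ)‖ ≤ 1 := by
    have h1 := abs_log_one_sub_inv_sq_le hv2
    have h2 := abs_log_one_sub_inv_sq_le hu2
    have : (1 / 2 * Real.log (1 - 1 / (v : ℝ) ^ 2) - 1 / 2 * Real.log (1 - 1 / (u : ℝ) ^ 2) : ℂ) =
        ((1 / 2 * (Real.log (1 - 1 / (v : ℝ) ^ 2) - Real.log (1 - 1 / (u : ℝ) ^ 2)) : ℝ) : ℂ) := by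
      push_cast; ring
    rw [this, Complex.norm_real, Real.norm_eq_abs, abs_mul, abs_of_pos (by norm_num : (0:ℝ) < 1/2)]
    have := abs_sub (Real.log (1 - 1 / (v : ℝ) ^ 2)) (Real.log (1 - 1 / (u : ℝ) ^ 2))
    linarith
  -- `A v − A u = (v − u) − (Zv − Zu) − (L-terms)`
  have hAA : A v - A u = ((v : ℝ) : ℂ) - ((u : ℝ) : ℂ) - (zetaZeroSumTrunc v T - zetaZeroSumTrunc u T) -
      ((1 / 2 * Real.log (1 - 1 / (v : ℝ) ^ 2) - 1 / 2 * Real.log (1 - 1 / (u : ℝ) ^ 2) : ℂ)) := by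
    simp only [hA]; ring
  -- `ψ₀` at the integers and the von Mangoldt jumps
  have hψ₀v : chebyshevPsi₀ v = ψ (v : ℝ) - Λ v / 2 := chebyshevPsi₀_natCast hv1
  have hψ₀u : chebyshevPsi₀ u = ψ (u : ℝ) - Λ u / 2 := chebyshevPsi₀_natCast hu1
  have hΛv : (Λ v : ℝ) ≤ Real.log v := ArithmeticFunction.vonMangoldt_le_log
  have hΛu : (Λ u : ℝ) ≤ Real.log u := ArithmeticFunction.vonMangoldt_le_log
  have hΛv0 : 0 ≤ (Λ v : ℝ) := ArithmeticFunction.vonMangoldt_nonneg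
  have hΛu0 : 0 ≤ (Λ u : ℝ) := ArithmeticFunction.vonMangoldt_nonneg
  have hloguv : Real.log u ≤ Real.log v := Real.log_le_log (by linarith) huv'
  have hlogv0 : 0 ≤ Real.log v := Real.log_nonneg (by linarith)
  have hJ : ‖(((Λ v : ℝ) / 2 - (Λ u : ℝ) / 2 : ℝ) : ℂ)‖ ≤ Real.log v := by
    rw [Complex.norm_real, Real.norm_eq_abs, abs_le]
    constructor <;> linarith
  -- `gallagherTerm = (ψ v − ψ u) − (v − u) − PP`
  have hcard : (((Ioc (v - (v - u)) v).card : ℕ) : ℂ) = ((v : ℝ) : ℂ) - ((u : ℝ) : ℂ) := by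
    rw [Nat.card_Ioc]
    have : v - (v - (v - u)) = v - u := by omega
    rw [this]; push_cast [Nat.cast_sub huv]; ring
  have hG : gallagherTerm χ v (v - u) =
      (((ψ (v : ℝ) - ψ (u : ℝ) : ℝ)) : ℂ) - (((v : ℝ) : ℂ) - ((u : ℝ) : ℂ)) -
        ∑ n ∈ (Ioc (v - (v - u)) v).filter (fun n => ¬ n.Prime), χ n * Λ n := by
    rw [gallagherTerm, if_pos rfl, hcard]
    have h1 := sum_Ioc_mul_vonMangoldt_eq χ v (v - u)
    rw [sum_Ioc_mul_vonMangoldt_modOne χ v (v - u), Nat.sub_sub_self huv] at h1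
    have h2 : charPrimeSum χ v (v - u) = (((ψ (v : ℝ) - ψ (u : ℝ) : ℝ)) : ℂ) -
        ∑ n ∈ (Ioc (v - (v - u)) v).filter (fun n => ¬ n.Prime), χ n * Λ n := by
      rw [Nat.sub_sub_self huv]
      linear_combination -h1
    rw [h2]
    ring
  have hPP := norm_sum_nonprime_le χ v (v - u)
  -- the identity
  have hid : gallagherTerm χ v (v - u) + (zetaZeroSumTrunc v T - zetaZeroSumTrunc u T) =
      ((chebyshevPsi₀ v : ℂ) - A v) - ((chebyshevPsi₀ u : ℂ) - A u)
      - ((1 / 2 * Real.log (1 - 1 / (v : ℝ) ^ 2) - 1 / 2 * Real.log (1 - 1 / (u : ℝ) ^ 2) : ℂ))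
      + (((Λ v : ℝ) / 2 - (Λ u : ℝ) / 2 : ℝ) : ℂ)
      - ∑ n ∈ (Ioc (v - (v - u)) v).filter (fun n => ¬ n.Prime), χ n * Λ n := by
    rw [hG, hψ₀v, hψ₀u]
    have h2 := hAA
    push_cast at h2 ⊢
    linear_combination h2
  rw [hid]
  have hn := norm_sub_le
    (((chebyshevPsi₀ v : ℂ) - A v) - ((chebyshevPsi₀ u : ℂ) - A u)
      - ((1 / 2 * Real.log (1 - 1 / (v : ℝ) ^ 2) - 1 / 2 * Real.log (1 - 1 / (u : ℝ) ^ 2) : ℂ))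
      + (((Λ v : ℝ) / 2 - (Λ u : ℝ) / 2 : ℝ) : ℂ))
    (∑ n ∈ (Ioc (v - (v - u)) v).filter (fun n => ¬ n.Prime), χ n * Λ n)
  have hn2 := norm_add_le
    (((chebyshevPsi₀ v : ℂ) - A v) - ((chebyshevPsi₀ u : ℂ) - A u)
      - ((1 / 2 * Real.log (1 - 1 / (v : ℝ) ^ 2) - 1 / 2 * Real.log (1 - 1 / (u : ℝ) ^ 2) : ℂ)))
    ((((Λ v : ℝ) / 2 - (Λ u : ℝ) / 2 : ℝ) : ℂ))
  have hn3 := norm_sub_le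
    (((chebyshevPsi₀ v : ℂ) - A v) - ((chebyshevPsi₀ u : ℂ) - A u))
    ((1 / 2 * Real.log (1 - 1 / (v : ℝ) ^ 2) - 1 / 2 * Real.log (1 - 1 / (u : ℝ) ^ 2) : ℂ))
  have hn4 := norm_sub_le ((chebyshevPsi₀ v : ℂ) - A v) ((chebyshevPsi₀ u : ℂ) - A u)
  have hE0 : 0 ≤ E := by
    have := hRem0 v hv2
    have hRemv : Rem v ≤ E := hRem_le v hv2 le_rfl
    linarith
  have hsqrt : 0 ≤ 2 * Real.sqrt v * Real.log v := by positivity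
  rw [hCdef]
  nlinarith [hRv, hRu, hL, hJ, hPP, hn, hn2, hn3, hn4, hlogv0, hE0, hC0]

end Literature.NumberTheory.Sieve.MontgomeryVaughan1975
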